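import Summits.KontsevichZagierPeriods.KontsevichZagierPeriods.Theorems.HurwitzMicroSectorsNormalFormPrincipleL2W3MoebiusMove
import Summits.KontsevichZagierPeriods.KontsevichZagierPeriods.Theorems.HyperbolicBlochOffTetraSectorKernelStubAffineOrbit

/-!
# `NormalFormPrinciple` (stmt-KontsevichZagierPeriods-3869), line `SketchIdeator1` —
# leaf `stub_boxRigidity`, layer `L2W3` (level-2 weight-3 descent): Möbius relation package THREE

Pure proof file (registered sub-goal `l2w3_relations_moebius_three` of the layer `L2W3`, lead
seat c9; `--supports` the crux). Letters on `(0,1)`: `a u = 1/u`, `b u = 1/(1 − u)`,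
`c u = 1/(1 + u)`; a *word representation* `[Δ, x(t₀) y(t₁) z(t₂)]` on the decreasing open
simplex `Δ = {t | 0 < t₂ < t₁ < t₀ < 1}` is the iterated integral `∫ x y z`. The word carriers
are hypotheses of the statement (domain `Δ`, integrand written out letter by letter).

The relation (rel9)

  `[AAB] + [AAC] − [ACB] − [ACC] − [CAB] − [CAC] + [CCB] + [CCC] − [ABB] ∈ KZ.relations`

is ONE Möbius move of the Kontsevich–Zagier calculus followed by integrand additivity:
* rule (2), the landed generic move `M3.l2w3_moebius_move` (the involution
  `σ(u) = (1 − u)/(1 + u)` on all three coordinates with order reversal, Jacobian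
  `∏ 2/(1 + tᵢ)²`) applied to the word `a b b`: it yields a representation `N` on `Δ` with
  `[N] − [ABB] ∈ relations` and integrand
  `N(t) = (b(σ t₀)·2/(1+t₀)²) (b(σ t₁)·2/(1+t₁)²) (a(σ t₂)·2/(1+t₂)²)`;
* the letter pull-backs `b(σ u)·2/(1+u)² = a u − c u` and `a(σ u)·2/(1+u)² = b u + c u`
  (`0 < u < 1`), so that pointwise on `Δ`
  `N = (a − c)(t₀) (a − c)(t₁) (b + c)(t₂) = aab + aac − acb − acc − cab − cac + ccb + ccc`;
* iterated rule (1b) (`aff_orbit_of_sub_sum_zsmul_mem_relations`, eight carriers with the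
  coefficient vector `(1, 1, −1, −1, −1, −1, 1, 1)`): `[N] − Σ ± [word] ∈ relations`;
* bookkeeping in the free abelian group.

References: M. Kontsevich, D. Zagier, *Periods* (2001), §1.1–1.2, rules (1b), (2); J. Zhao,
*Multiple polylogarithm values at roots of unity*, C. R. Acad. Sci. Paris 346 (2008), §4 (the
involution `σ`). No definitions are introduced.
-/

noncomputable section

open MeasureTheory Set
open Literature.NumberTheory.Transcendental Literature.NumberTheory.Transcendental.KZ
open Literature.ModelTheory.ExponentialFields (IsSemialgebraic)
open Summit.KontsevichZagierPeriods.HyperbolicBloch.OffTetraSectorKernel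
  (aff_orbit_of_sub_sum_zsmul_mem_relations)

namespace Summit.KontsevichZagierPeriods.HurwitzMicroSectors.NormalFormPrinciple.PiBox.M3

/-! ## Side conditions on `Δ` and the two Möbius letter pull-backs -/

/-- On the decreasing open simplex every coordinate lies in `(0,1)`. [folklore] -/
private theorem l2t_simplex_facts {t : Fin 3 → ℝ}
    (ht : t ∈ {t : Fin 3 → ℝ | 0 < t 2 ∧ t 2 < t 1 ∧ t 1 < t 0 ∧ t 0 < 1}) :
    (0 < t 0 ∧ t 0 < 1) ∧ (0 < t 1 ∧ t 1 < 1) ∧ (0 < t 2 ∧ t 2 < 1) := by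
  obtain ⟨h2, h21, h10, h0⟩ := ht
  exact ⟨⟨by linarith, h0⟩, ⟨by linarith, by linarith⟩, ⟨h2, by linarith⟩⟩

/-- Möbius pull-back of the letter `a u = 1/u` with the Jacobian factor:
`a(σ u) · 2/(1+u)² = b u + c u` for `0 < u < 1`, `σ u = (1 − u)/(1 + u)`. [folklore] -/
private theorem l2t_pull_a {u : ℝ} (hu : 0 < u ∧ u < 1) :
    1 / ((1 - u) / (1 + u)) * (2 / (1 + u) ^ 2) = 1 / (1 - u) + 1 / (1 + u) := by
  have h1 : (1:ℝ) + u ≠ 0 := by linarith [hu.1]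
  have h2 : (1:ℝ) - u ≠ 0 := by linarith [hu.2]
  field_simp
  ring

/-- Möbius pull-back of the letter `b u = 1/(1 − u)` with the Jacobian factor:
`b(σ u) · 2/(1+u)² = a u − c u` for `0 < u < 1`, `σ u = (1 − u)/(1 + u)`. [folklore] -/
private theorem l2t_pull_b {u : ℝ} (hu : 0 < u ∧ u < 1) :
    1 / (1 - (1 - u) / (1 + u)) * (2 / (1 + u) ^ 2) = 1 / u - 1 / (1 + u) := by
  have h1 : (1:ℝ) + u ≠ 0 := by linarith [hu.1]
  have h2 : u ≠ 0 := hu.1.ne'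
  have h3 : 1 - (1 - u) / (1 + u) = 2 * u / (1 + u) := by
    field_simp
    ring
  rw [h3]
  field_simp
  ring

/-! ## The relation package -/

/-- **Möbius relation package THREE** (rel9). One Möbius move (`l2w3_moebius_move`, rule (2)) on
the word `a b b` followed by integrand additivity (rule (1b)) on the decreasing open simplex:
`[AAB] + [AAC] − [ACB] − [ACC] − [CAB] − [CAC] + [CCB] + [CCC] − [ABB] ∈ KZ.relations`, the
carriers being any representations on `Δ` with the displayed word integrands.
[cite: KontsevichZagier2001, §1.2 rules (1), (2)] -/
theorem l2w3_relations_moebius_three :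
    (∀ (ABB : IntegralRep 3), ABB.domain = {t | 0 < t 2 ∧ t 2 < t 1 ∧ t 1 < t 0 ∧ t 0 < 1} →
        (ABB.integrand = fun t => 1 / t 0 * (1 / (1 - t 1)) * (1 / (1 - t 2))) →
      ∀ (AAB : IntegralRep 3), AAB.domain = {t | 0 < t 2 ∧ t 2 < t 1 ∧ t 1 < t 0 ∧ t 0 < 1} →
        (AAB.integrand = fun t => 1 / t 0 * 1 / t 1 * (1 / (1 - t 2))) →
      ∀ (AAC : IntegralRep 3), AAC.domain = {t | 0 < t 2 ∧ t 2 < t 1 ∧ t 1 < t 0 ∧ t 0 < 1} →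
        (AAC.integrand = fun t => 1 / t 0 * 1 / t 1 * (1 / (1 + t 2))) →
      ∀ (ACB : IntegralRep 3), ACB.domain = {t | 0 < t 2 ∧ t 2 < t 1 ∧ t 1 < t 0 ∧ t 0 < 1} →
        (ACB.integrand = fun t => 1 / t 0 * (1 / (1 + t 1)) * (1 / (1 - t 2))) →
      ∀ (ACC : IntegralRep 3), ACC.domain = {t | 0 < t 2 ∧ t 2 < t 1 ∧ t 1 < t 0 ∧ t 0 < 1} →
        (ACC.integrand = fun t => 1 / t 0 * (1 / (1 + t 1)) * (1 / (1 + t 2))) →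
      ∀ (CAB : IntegralRep 3), CAB.domain = {t | 0 < t 2 ∧ t 2 < t 1 ∧ t 1 < t 0 ∧ t 0 < 1} →
        (CAB.integrand = fun t => 1 / (1 + t 0) * 1 / t 1 * (1 / (1 - t 2))) →
      ∀ (CAC : IntegralRep 3), CAC.domain = {t | 0 < t 2 ∧ t 2 < t 1 ∧ t 1 < t 0 ∧ t 0 < 1} →
        (CAC.integrand = fun t => 1 / (1 + t 0) * 1 / t 1 * (1 / (1 + t 2))) →
      ∀ (CCB : IntegralRep 3), CCB.domain = {t | 0 < t 2 ∧ t 2 < t 1 ∧ t 1 < t 0 ∧ t 0 < 1} →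
        (CCB.integrand = fun t => 1 / (1 + t 0) * (1 / (1 + t 1)) * (1 / (1 - t 2))) →
      ∀ (CCC : IntegralRep 3), CCC.domain = {t | 0 < t 2 ∧ t 2 < t 1 ∧ t 1 < t 0 ∧ t 0 < 1} →
        (CCC.integrand = fun t => 1 / (1 + t 0) * (1 / (1 + t 1)) * (1 / (1 + t 2))) →
        of AAB + of AAC - of ACB - of ACC - of CAB - of CAC + of CCB + of CCC - of ABB ∈ relations) := by
  intro ABB hABBd hABBi AAB hAABd hAABi AAC hAACd hAACi ACB hACBd hACBi ACC hACCd hACCi CAB hCABd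
    hCABi CAC hCACd hCACi CCB hCCBd hCCBi CCC hCCCd hCCCi
  -- (rule 2) the Möbius move on the word `a b b`
  obtain ⟨hmove, ⟨N, hNd, hNi⟩⟩ := l2w3_moebius_move (fun u => 1 / u) (fun u => 1 / (1 - u))
    (fun u => 1 / (1 - u)) ABB hABBd (hABBi ▸ fun _ _ => rfl)
  have m1 : of N - of ABB ∈ relations := hmove N hNd (hNi ▸ fun _ _ => rfl)
  -- (rule 1b) the eight-term expansion of the pulled-back integrand
  have m2 : of N - ((1:ℤ) • of AAB + (1:ℤ) • of AAC + (-1:ℤ) • of ACB + (-1:ℤ) • of ACC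
      + (-1:ℤ) • of CAB + (-1:ℤ) • of CAC + (1:ℤ) • of CCB + (1:ℤ) • of CCC) ∈ relations := by
    have h := aff_orbit_of_sub_sum_zsmul_mem_relations (Finset.univ : Finset (Fin 8))
      ![AAB, AAC, ACB, ACC, CAB, CAC, CCB, CCC] ![1, 1, -1, -1, -1, -1, 1, 1] N (fun i _ => by
        fin_cases i
        · exact hAABd.trans hNd.symm
        · exact hAACd.trans hNd.symm
        · exact hACBd.trans hNd.symm
        · exact hACCd.trans hNd.symm
        · exact hCABd.trans hNd.symm
        · exact hCACd.trans hNd.symm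
        · exact hCCBd.trans hNd.symm
        · exact hCCCd.trans hNd.symm) fun t ht => ?_
    · simpa [Fin.sum_univ_eight, add_assoc] using h
    have hf := l2t_simplex_facts (hNd ▸ ht)
    rw [hNi]
    have hs : ∀ t : Fin 3 → ℝ, (∑ i : Fin 8, ((![1, 1, -1, -1, -1, -1, 1, 1] : Fin 8 → ℤ) i : ℝ) *
        ((![AAB, AAC, ACB, ACC, CAB, CAC, CCB, CCC] : Fin 8 → IntegralRep 3) i).integrand t) =
        AAB.integrand t + AAC.integrand t - ACB.integrand t - ACC.integrand t
          - CAB.integrand t - CAC.integrand t + CCB.integrand t + CCC.integrand t := fun t => by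
      simp [Fin.sum_univ_eight]
      ring
    simp only [hs]
    simp only [hAABi, hAACi, hACBi, hACCi, hCABi, hCACi, hCCBi, hCCCi]
    rw [l2t_pull_b hf.1, l2t_pull_b hf.2.1, l2t_pull_a hf.2.2]
    ring
  -- bookkeeping in the free abelian group
  have e : of AAB + of AAC - of ACB - of ACC - of CAB - of CAC + of CCB + of CCC - of ABB =
      (of N - of ABB) - (of N - ((1:ℤ) • of AAB + (1:ℤ) • of AAC + (-1:ℤ) • of ACB
        + (-1:ℤ) • of ACC + (-1:ℤ) • of CAB + (-1:ℤ) • of CAC + (1:ℤ) • of CCB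
        + (1:ℤ) • of CCC)) := by
    simp only [one_smul, neg_smul]
    abel
  rw [e]
  exact relations.sub_mem m1 m2

end Summit.KontsevichZagierPeriods.HurwitzMicroSectors.NormalFormPrinciple.PiBox.M3
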